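import Summits.Ventures.PercRepro.ProfilePointedCircuitClassesInOutFreeII

/-!
# PercRepro — THE SINGLE-TRIANGLE CASE OF `InOutBottomFour`, II: THE SPLIT OF THE DEMANDS AND UNITS BY THE TRIANGLE
(p5, gen 38; `proofs/P5-GM1.md` §54 ADDENDUM 2 (1))

On `#E = ρ + 4` let `e ∈ cl{f, g}` (a triangle `{e, f, g}`) and suppose every independent `(ρ − 2)`-subset of
`E − e` whose closure contains `e` contains `f` and `g` (no other circuit through `e` has `≤ ρ − 1` elements).  With
`H := E − e` and `H₀ := E − e − f − g`:
* the bi-independent `4`-sets through `e` inject (`W ↦ W − e`) into the `3`-subsets `U` of `H` with `U ∈ ℐ`,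
  `H − U ∈ ℐ`, `{f, g} ⊄ U` (`inCount_four_le_card_demands_of_triangle`), and these split by `U ∩ {f, g}` into the
  three families `D₀ = {Y ⊆ H₀ : #Y = 3, Y ∈ ℐ, (H₀ − Y) + f + g ∈ ℐ}`, `D_f = {Y ⊆ H₀ : #Y = 2, Y + f ∈ ℐ,
  (H₀ − Y) + g ∈ ℐ}`, `D_g` (`card_demands_le_of_triangle`);
* (the unit side — the `5`-subsets of `H` meeting `{f, g}` with independent complement are bi-independent `5`-sets of
  `N` avoiding `e`, and they contain the three disjoint families `U_{fg}`, `U_f`, `U_g` — is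
  ProfilePointedCircuitClassesInOutTriangleIII).
So `in_4(e) ≤ #D₀ + #D_f + #D_g`; the comparisons `#D_f ≤ #U_f`, `#D_g ≤ #U_g` are
`mixedTwo_le_mixedFour_of_nullity_three` on `N ∖ e`, and `#D₀ ≤ #U_{fg}` is the open piece `(G)` (the assembly is
ProfilePointedCircuitClassesInOutTriangleIV).
-/

open scoped Matroid

namespace PercRepro.Cogirth

open Finset ThmH Skew Shadow Profile

variable {α : Type} [DecidableEq α] {N : Matroid α} [N.Finite]

section TriangleSplit

/-- `in_4(e) ≤ #{U ⊆ E − e : #U = 3, U ∈ ℐ, (E − e) − U ∈ ℐ, {f, g} ⊄ U}` when `e ∈ cl{f, g}`. -/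
theorem inCount_four_le_card_demands_of_triangle {e f g : α} (htri : e ∈ clF N {f, g}) :
    inCount N 4 e ≤ ((((gr N).erase e).powersetCard 3).filter (fun U => rk N U = 3 ∧
      rk N ((gr N).erase e \ U) = ((gr N).erase e \ U).card ∧ ¬ ({f, g} ⊆ U))).card := by
  unfold inCount
  apply card_le_card_of_injOn (fun W => W.erase e)
  · intro W hW
    rw [mem_coe, mem_filter, mem_biIndepSets] at hW
    obtain ⟨⟨hWg, hW4, hWrk, hWc⟩, heW⟩ := hW
    show W.erase e ∈ (((gr N).erase e).powersetCard 3).filter (fun U => rk N U = 3 ∧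
      rk N ((gr N).erase e \ U) = ((gr N).erase e \ U).card ∧ ¬ ({f, g} ⊆ U))
    rw [mem_filter, mem_powersetCard]
    have hWe : W.erase e ⊆ (gr N).erase e := erase_subset_erase e hWg
    have e1 : (gr N).erase e \ W.erase e = gr N \ W := by
      ext a
      simp only [mem_sdiff, mem_erase]
      constructor
      · rintro ⟨⟨hae, hag⟩, h⟩
        exact ⟨hag, fun haW => h ⟨hae, haW⟩⟩
      · rintro ⟨hag, haW⟩
        exact ⟨⟨fun h => haW (h ▸ heW), hag⟩, fun h => haW h.2⟩
    refine ⟨⟨hWe, by rw [card_erase_of_mem heW, hW4]⟩, ?_, ?_, ?_⟩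
    · have := rk_eq_card_of_subset_of_rk_eq_card (erase_subset e W) hWrk
      rwa [card_erase_of_mem heW, hW4] at this
    · rw [e1]
      exact hWc
    · -- `{f, g} ⊆ W − e` would put `e ∈ cl(W − e)`, against `W ∈ ℐ`
      intro hfg
      have heg : e ∈ gr N := hWg heW
      have hecl : e ∈ clF N (W.erase e) := mem_clF_of_subset hfg htri
      rw [mem_clF_iff_rk_insert_eq heg ((erase_subset _ _).trans hWg), insert_erase heW] at hecl
      have := rk_le_card (M := N) (W.erase e)
      rw [card_erase_of_mem heW] at this
      omega
  · intro W hW W' hW' h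
    rw [mem_coe, mem_filter] at hW hW'
    simp only at h
    rw [← insert_erase hW.2, ← insert_erase hW'.2, h]

/-- The demands split by `U ∩ {f, g}`: `#D ≤ #D₀ + #D_f + #D_g` (`D` the set of
`inCount_four_le_card_demands_of_triangle`, the three families on `H₀ := E − e − f − g`). -/
theorem card_demands_le_of_triangle {e f g : α} (hf : f ∈ (gr N).erase e) (hg : g ∈ (gr N).erase e) (hfg : f ≠ g) :
    ((((gr N).erase e).powersetCard 3).filter (fun U => rk N U = 3 ∧
      rk N ((gr N).erase e \ U) = ((gr N).erase e \ U).card ∧ ¬ ({f, g} ⊆ U))).card ≤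
    ((((((gr N).erase e).erase f).erase g).powersetCard 3).filter (fun Y => rk N Y = 3 ∧
      rk N ((((gr N).erase e).erase f).erase g \ Y ∪ {f, g}) = ((((gr N).erase e).erase f).erase g \ Y ∪ {f, g}).card)).card +
    ((((((gr N).erase e).erase f).erase g).powersetCard 2).filter (fun Y => rk N (insert f Y) = 3 ∧
      rk N (insert g ((((gr N).erase e).erase f).erase g \ Y)) = (insert g ((((gr N).erase e).erase f).erase g \ Y)).card)).card +
    ((((((gr N).erase e).erase f).erase g).powersetCard 2).filter (fun Y => rk N (insert g Y) = 3 ∧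
      rk N (insert f ((((gr N).erase e).erase f).erase g \ Y)) = (insert f ((((gr N).erase e).erase f).erase g \ Y)).card)).card := by
  obtain ⟨H, hH⟩ : ∃ H : Finset α, H = (gr N).erase e := ⟨_, rfl⟩
  obtain ⟨H₀, hH₀⟩ : ∃ H₀ : Finset α, H₀ = (H.erase f).erase g := ⟨_, rfl⟩
  rw [← hH] at hf hg ⊢
  rw [← hH₀]
  have hH₀H : H₀ ⊆ H := by rw [hH₀]; exact (erase_subset _ _).trans (erase_subset _ _)
  have hfH₀ : f ∉ H₀ := by rw [hH₀]; intro h; exact (mem_erase.1 (erase_subset _ _ h)).1 rfl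
  have hgH₀ : g ∉ H₀ := by rw [hH₀]; intro h; exact (mem_erase.1 h).1 rfl
  have hmemH₀ : ∀ a, a ∈ H₀ ↔ a ∈ H ∧ a ≠ f ∧ a ≠ g := by
    intro a; rw [hH₀]; simp only [mem_erase]; tauto
  -- the three sub-families of `D`
  obtain ⟨D, hD⟩ : ∃ D : Finset (Finset α), D = (H.powersetCard 3).filter (fun U => rk N U = 3 ∧
      rk N (H \ U) = (H \ U).card ∧ ¬ ({f, g} ⊆ U)) := ⟨_, rfl⟩
  rw [← hD]
  have hsplit : D ⊆ D.filter (fun U => f ∉ U ∧ g ∉ U) ∪ D.filter (fun U => f ∈ U ∧ g ∉ U) ∪ D.filter (fun U => f ∉ U ∧ g ∈ U) := by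
    intro U hU
    have hU' := hU
    rw [hD, mem_filter] at hU'
    have hnot : ¬ ({f, g} ⊆ U) := hU'.2.2.2
    by_cases hfU : f ∈ U <;> by_cases hgU : g ∈ U
    · exact absurd (insert_subset hfU (singleton_subset_iff.2 hgU)) hnot
    · exact mem_union.2 (Or.inl (mem_union.2 (Or.inr (mem_filter.2 ⟨hU, hfU, hgU⟩))))
    · exact mem_union.2 (Or.inr (mem_filter.2 ⟨hU, hfU, hgU⟩))
    · exact mem_union.2 (Or.inl (mem_union.2 (Or.inl (mem_filter.2 ⟨hU, hfU, hgU⟩))))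
  have h1 := card_le_card hsplit
  have h2 := card_union_le (D.filter (fun U => f ∉ U ∧ g ∉ U) ∪ D.filter (fun U => f ∈ U ∧ g ∉ U)) (D.filter (fun U => f ∉ U ∧ g ∈ U))
  have h3 := card_union_le (D.filter (fun U => f ∉ U ∧ g ∉ U)) (D.filter (fun U => f ∈ U ∧ g ∉ U))
  -- `D₀`: identity
  have hA : (D.filter (fun U => f ∉ U ∧ g ∉ U)).card ≤ ((H₀.powersetCard 3).filter (fun Y => rk N Y = 3 ∧
      rk N (H₀ \ Y ∪ {f, g}) = (H₀ \ Y ∪ {f, g}).card)).card := by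
    apply card_le_card
    intro U hU
    rw [mem_filter, hD, mem_filter, mem_powersetCard] at hU
    obtain ⟨⟨⟨hUH, hU3⟩, hUrk, hUc, _⟩, hfU, hgU⟩ := hU
    rw [mem_filter, mem_powersetCard]
    have hUH₀ : U ⊆ H₀ := fun a ha => (hmemH₀ a).2 ⟨hUH ha, fun h => hfU (h ▸ ha), fun h => hgU (h ▸ ha)⟩
    have e1 : H₀ \ U ∪ {f, g} = H \ U := by
      ext a
      simp only [mem_union, mem_sdiff, mem_insert, mem_singleton, hmemH₀]
      constructor
      · rintro (⟨⟨haH, _, _⟩, haU⟩ | rfl | rfl)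
        · exact ⟨haH, haU⟩
        · exact ⟨hf, hfU⟩
        · exact ⟨hg, hgU⟩
      · rintro ⟨haH, haU⟩
        by_cases haf : a = f
        · exact Or.inr (Or.inl haf)
        by_cases hag : a = g
        · exact Or.inr (Or.inr hag)
        exact Or.inl ⟨⟨haH, haf, hag⟩, haU⟩
    rw [e1]
    exact ⟨⟨hUH₀, hU3⟩, hUrk, hUc⟩
  -- `D_f`: `U ↦ U − f`
  have hB : (D.filter (fun U => f ∈ U ∧ g ∉ U)).card ≤ ((H₀.powersetCard 2).filter (fun Y => rk N (insert f Y) = 3 ∧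
      rk N (insert g (H₀ \ Y)) = (insert g (H₀ \ Y)).card)).card := by
    apply card_le_card_of_injOn (fun U => U.erase f)
    · intro U hU
      rw [mem_coe, mem_filter, hD, mem_filter, mem_powersetCard] at hU
      obtain ⟨⟨⟨hUH, hU3⟩, hUrk, hUc, _⟩, hfU, hgU⟩ := hU
      show U.erase f ∈ (H₀.powersetCard 2).filter (fun Y => rk N (insert f Y) = 3 ∧
        rk N (insert g (H₀ \ Y)) = (insert g (H₀ \ Y)).card)
      rw [mem_filter, mem_powersetCard]
      have hUeH₀ : U.erase f ⊆ H₀ := by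
        intro a ha
        rw [mem_erase] at ha
        exact (hmemH₀ a).2 ⟨hUH ha.2, ha.1, fun h => hgU (h ▸ ha.2)⟩
      have e1 : insert g (H₀ \ U.erase f) = H \ U := by
        ext a
        simp only [mem_insert, mem_sdiff, mem_erase, hmemH₀, not_and]
        constructor
        · rintro (rfl | ⟨⟨haH, haf, hag⟩, h⟩)
          · exact ⟨hg, hgU⟩
          · exact ⟨haH, fun haU => h haf haU⟩
        · rintro ⟨haH, haU⟩
          by_cases hag : a = g
          · exact Or.inl hag
          · exact Or.inr ⟨⟨haH, fun h => haU (h ▸ hfU), hag⟩, fun _ h => haU h⟩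
      refine ⟨⟨hUeH₀, by rw [card_erase_of_mem hfU, hU3]⟩, by rw [insert_erase hfU, hUrk], ?_⟩
      rw [e1]
      exact hUc
    · intro U hU U' hU' h
      rw [mem_coe, mem_filter] at hU hU'
      simp only at h
      rw [← insert_erase hU.2.1, ← insert_erase hU'.2.1, h]
  -- `D_g`: `U ↦ U − g`
  have hC : (D.filter (fun U => f ∉ U ∧ g ∈ U)).card ≤ ((H₀.powersetCard 2).filter (fun Y => rk N (insert g Y) = 3 ∧
      rk N (insert f (H₀ \ Y)) = (insert f (H₀ \ Y)).card)).card := by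
    apply card_le_card_of_injOn (fun U => U.erase g)
    · intro U hU
      rw [mem_coe, mem_filter, hD, mem_filter, mem_powersetCard] at hU
      obtain ⟨⟨⟨hUH, hU3⟩, hUrk, hUc, _⟩, hfU, hgU⟩ := hU
      show U.erase g ∈ (H₀.powersetCard 2).filter (fun Y => rk N (insert g Y) = 3 ∧
        rk N (insert f (H₀ \ Y)) = (insert f (H₀ \ Y)).card)
      rw [mem_filter, mem_powersetCard]
      have hUeH₀ : U.erase g ⊆ H₀ := by
        intro a ha
        rw [mem_erase] at ha
        exact (hmemH₀ a).2 ⟨hUH ha.2, fun h => hfU (h ▸ ha.2), ha.1⟩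
      have e1 : insert f (H₀ \ U.erase g) = H \ U := by
        ext a
        simp only [mem_insert, mem_sdiff, mem_erase, hmemH₀, not_and]
        constructor
        · rintro (rfl | ⟨⟨haH, haf, hag⟩, h⟩)
          · exact ⟨hf, hfU⟩
          · exact ⟨haH, fun haU => h hag haU⟩
        · rintro ⟨haH, haU⟩
          by_cases haf : a = f
          · exact Or.inl haf
          · exact Or.inr ⟨⟨haH, haf, fun h => haU (h ▸ hgU)⟩, fun _ h => haU h⟩
      refine ⟨⟨hUeH₀, by rw [card_erase_of_mem hgU, hU3]⟩, by rw [insert_erase hgU, hUrk], ?_⟩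
      rw [e1]
      exact hUc
    · intro U hU U' hU' h
      rw [mem_coe, mem_filter] at hU hU'
      simp only at h
      rw [← insert_erase hU.2.2, ← insert_erase hU'.2.2, h]
  omega

end TriangleSplit

end PercRepro.Cogirth
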